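import Mathlib
import Literature.Combinatorics.Optimization.MulticutCorrelations
import Literature.Combinatorics.Optimization.SparsePathDecomposable
import HarnessLib

/-!
# Locally consistent `±1` processes from multicut distributions WITH EDGE WEIGHTS `π_uv ∈ {−1,+1}`
# (Charikar–Makarychev–Makarychev 2009, Corollary 5.1 in its printed generality) — PROVED

[topic Combinatorics/Optimization]

`MulticutCorrelations.lean` formalises CMM09 Corollary 5.1 (p. 8–9) in the MAX-CUT case "all
`π_uv = −1`".  The printed corollary carries arbitrary edge weights, which is what the Unique Games gap
(Thm 6.1, p. 13: "Theorem 5.3 works not only for MAX CUT, but also for MAX 2LIN, we just need to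
substitute the metric `ρ^alt_µ` by the metric `ρ^π_µ`") consumes:

> (p. 8) "we introduce weights `π_uv ∈ {−1, +1}` for all edges `(u, v)` … Extend the function `π_uv`
> to all pairs of vertices as follows: if `d(u, v) ≤ 2L`, let `π_uv` be the product of the weights of
> all edges along the unique shortest path between `u` and `v`; otherwise (if `d(u, v) > 2L`), let
> `π_uv = 0`. … `ρ^π_µ(u, v) = (1 − (1 − µ)^{d(u,v)} π_uv)/2`."
>
> **Corollary 5.1.** "Suppose `G = (V, E)` is an `l`-path decomposable graph. Let `L = ⌊l/9⌋`;
> `µ ∈ [1/L, 1]`; and `π_uv` be a set of weights (as above). There exists a random mapping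
> `ϕ : V → {−1, 1}` such that 1. if `d(u, v) ≤ L` then `Pr(ϕ(u) ≠ ϕ(v)) = ρ^π_µ(u, v)`; 2. if
> `d(u, v) ≥ L` then `(1−(1−µ)^L)/2 ≤ Pr(ϕ(u) ≠ ϕ(v)) ≤ (1+(1−µ)^L)/2`.  *Proof.* Consider the
> distribution of multicuts from Theorem 2.4. For each piece of the multicut partition (recall that
> each piece is a tree) pick an arbitrary vertex `u` and set `φ(u)` to be `+1` or `−1` with probability
> a half. Then propagate values along the edges of the tree so that `φ(u'') = π_{u'u''} φ(u')` for
> adjacent `(u', u'')`."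

As in the unsigned file we formalise the matrix of pair correlations `E[ϕ(u)ϕ(v)] = 1 − 2 Pr(ϕ(u) ≠ ϕ(v))`
of this process (the object consumed by Thm 5.2/5.3), for a good multicut distribution `p` on `E`
(`GoodMulticut µ L E p`) and a weight `π : Sym2 V → Bool` (`true` = weight `−1`):

* `wsign π w` — the product of the weights along a walk `w`; `spot π Z v` — "propagate values along
  the edges of the tree": the product of the weights along a path from a fixed root of the piece of
  `v` in the forest `gr Z` (`spot_mul_spot_of_adj`: `φ(u'') φ(u') = π_{u'u''}` on the edges of a forest,
  from Mathlib's `IsAcyclic.path_concat`; `spot_mul_spot_eq_wsign`: `φ(u)φ(v) = ` the weight of ANY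
  walk from `u` to `v` inside the forest);
* `sscorr π Z u v = [u ~ v]·φ(u)φ(v)` (conditional correlation given the surviving edge set `Z`) and the
  kernel `corrS π p E u v = Σ_S p(S)·sscorr π (E∖S) u v`;
* `corrS_posSemidef` — positive semidefinite on every vertex set (a second-moment matrix; proved from
  the factorisation through `φ` and `sum_sum_jind_nonneg`, for every nonnegative `p`);
* the printed values: `corrS_eq_of_edist_le` — `d_E(u,v) = k ≤ L ⇒ E[ϕ(u)ϕ(v)] = π_uv (1−µ)^k`
  (condition 1), where `π_uv = psgn π E u v` is the weight of a shortest path, under the hypothesis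
  `SignConsistent π E L` that shortest paths of length `≤ L` between the same endpoints have equal
  weights — the tree's rendering of "the unique shortest path", supplied by `signConsistent_of_girth`
  (girth `> 2L`, which the CMM gap graphs have: `RandomPairMultigraphPruned.girth_pruned`);
  `abs_corrS_le_of_lt_edist` — `d_E(u,v) > L ⇒ |E[ϕ(u)ϕ(v)]| ≤ (1−µ)^L` (condition 2);
* `psgn_of_adj` (`π_uv` on an edge is the edge weight), `psgn_comm`, `psgn_self`.

Everything is proved; no named facts.

## References

* [CharikarMakarychevMakarychev2009] M. Charikar, K. Makarychev, Y. Makarychev, *Integrality gaps for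
  Sherali–Adams relaxations*, STOC 2009, doi:10.1145/1536414.1536455; §5 p. 8 (weights `π_uv`,
  metric `ρ^π_µ`), Cor. 5.1 (p. 8–9), Thm 6.1 proof sketch (p. 13).  Held text
  `paper:doi-10-1145-1536414-1536455`.
* [CharikarMakarychevMakarychev2010] M. Charikar, K. Makarychev, Y. Makarychev, *Local global
  tradeoffs in metric embeddings*, SIAM J. Comput. 39 (2010); Thm 3.3 (p. 16).
-/

noncomputable section

open Finset SimpleGraph Matrix

namespace Literature.Combinatorics.Optimization

namespace Multicut

variable {V : Type*}

/-! ### Weights of edges and of walks -/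

/-- The weight `π_e ∈ {−1,+1}` of an edge, encoded by `π : Sym2 V → Bool` (`true` = `−1`).
[cite: CharikarMakarychevMakarychev2009, §5 (p. 8: "weights π_uv ∈ {−1, +1} for all edges")] -/
def esgn (π : Sym2 V → Bool) (e : Sym2 V) : ℝ := if π e then -1 else 1

/-- `π_e² = 1`. [cite: CharikarMakarychevMakarychev2009, §5 (p. 8)] -/
theorem esgn_mul_self (π : Sym2 V → Bool) (e : Sym2 V) : esgn π e * esgn π e = 1 := by
  unfold esgn; split_ifs <;> norm_num

/-- **The weight of a walk**: the product of the weights of its edges ("the product of the weights of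
all edges along the … path"). [cite: CharikarMakarychevMakarychev2009, §5 (p. 8)] -/
def wsign (π : Sym2 V → Bool) {G : SimpleGraph V} {u v : V} (w : G.Walk u v) : ℝ :=
  (w.edges.map (esgn π)).prod

section WSign

variable (π : Sym2 V → Bool) {G : SimpleGraph V}

/-- The empty walk has weight `1`. [cite: CharikarMakarychevMakarychev2009, §5 (p. 8)] -/
@[simp] theorem wsign_nil (u : V) : wsign π (Walk.nil : G.Walk u u) = 1 := by
  simp [wsign]

/-- Weight of a walk extended at the start. [cite: CharikarMakarychevMakarychev2009, §5 (p. 8)] -/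
@[simp] theorem wsign_cons {u v w : V} (h : G.Adj u v) (p : G.Walk v w) :
    wsign π (Walk.cons h p) = esgn π s(u, v) * wsign π p := by
  simp [wsign, Walk.edges_cons]

/-- Weight of a walk extended at the end. [cite: CharikarMakarychevMakarychev2009, §5 (p. 8: "propagate values along the edges")] -/
@[simp] theorem wsign_concat {u v w : V} (p : G.Walk u v) (h : G.Adj v w) :
    wsign π (p.concat h) = wsign π p * esgn π s(v, w) := by
  simp [wsign, Walk.edges_concat]

/-- The weight only depends on the list of edges. [cite: CharikarMakarychevMakarychev2009, §5 (p. 8)] -/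
theorem wsign_eq_of_edges_eq {H : SimpleGraph V} {u v u' v' : V} {p : G.Walk u v} {q : H.Walk u' v'}
    (h : p.edges = q.edges) : wsign π p = wsign π q := by
  unfold wsign; rw [h]

/-- A walk's weight is `±1`: its square is `1`. [cite: CharikarMakarychevMakarychev2009, §5 (p. 8)] -/
theorem wsign_mul_self {u v : V} (p : G.Walk u v) : wsign π p * wsign π p = 1 := by
  induction p with
  | nil => simp
  | cons h p ih =>
    rw [wsign_cons]
    calc esgn π s(_, _) * wsign π p * (esgn π s(_, _) * wsign π p)
        = (esgn π s(_, _) * esgn π s(_, _)) * (wsign π p * wsign π p) := by ring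
      _ = 1 := by rw [esgn_mul_self, ih, one_mul]

/-- `|weight| = 1`. [cite: CharikarMakarychevMakarychev2009, §5 (p. 8)] -/
theorem abs_wsign {u v : V} (p : G.Walk u v) : |wsign π p| = 1 := by
  have h := wsign_mul_self π p
  have : |wsign π p| * |wsign π p| = 1 := by rw [← abs_mul, h, abs_one]
  nlinarith [abs_nonneg (wsign π p)]

/-- Reversal does not change the weight. [cite: CharikarMakarychevMakarychev2009, §5 (p. 8)] -/
theorem wsign_reverse {u v : V} (p : G.Walk u v) : wsign π p.reverse = wsign π p := by
  unfold wsign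
  rw [Walk.edges_reverse, List.map_reverse, List.prod_reverse]

end WSign

/-! ### "Propagate values along the edges of the tree": the potential of a forest -/

/-- A fixed root in the piece (connected component of `gr Z`) of `v`.
[cite: CharikarMakarychevMakarychev2009, Cor. 5.1 proof (p. 8: "pick an arbitrary vertex u")] -/
def root (Z : Finset (Sym2 V)) (v : V) : V := Quot.out ((gr Z).connectedComponentMk v)

/-- The root of the piece of `v` is connected to `v`. [cite: CharikarMakarychevMakarychev2009, Cor. 5.1 proof (p. 8)] -/
theorem root_reachable (Z : Finset (Sym2 V)) (v : V) : (gr Z).Reachable (root Z v) v :=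
  ConnectedComponent.exact (Quot.out_eq _)

/-- Vertices of one piece have the same root. [cite: CharikarMakarychevMakarychev2009, Cor. 5.1 proof (p. 8)] -/
theorem root_eq_of_reachable {Z : Finset (Sym2 V)} {u v : V} (h : (gr Z).Reachable u v) :
    root Z u = root Z v := by
  unfold root; rw [ConnectedComponent.sound h]

/-- A path from the root of its piece to `v`. [cite: CharikarMakarychevMakarychev2009, Cor. 5.1 proof (p. 8)] -/
def rootPath (Z : Finset (Sym2 V)) (v : V) : (gr Z).Path (root Z v) v :=
  ⟨(root_reachable Z v).exists_path_of_dist.choose, (root_reachable Z v).exists_path_of_dist.choose_spec.1⟩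

/-- **The value `φ(v) ∈ {−1,+1}`** obtained by propagating `φ(u'') = π_{u'u''} φ(u')` from the root of
the piece of `v` (root value `+1`; the random global sign of the piece is irrelevant for the pair
correlations): the weight of a root-to-`v` path. [cite: CharikarMakarychevMakarychev2009, Cor. 5.1 proof (p. 8)] -/
def spot (π : Sym2 V → Bool) (Z : Finset (Sym2 V)) (v : V) : ℝ := wsign π (rootPath Z v).1

/-- `φ(v)² = 1`. [cite: CharikarMakarychevMakarychev2009, Cor. 5.1 proof (p. 8)] -/
theorem spot_mul_self (π : Sym2 V → Bool) (Z : Finset (Sym2 V)) (v : V) :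
    spot π Z v * spot π Z v = 1 :=
  wsign_mul_self π _

/-- `|φ(v)| = 1`. [cite: CharikarMakarychevMakarychev2009, Cor. 5.1 proof (p. 8)] -/
theorem abs_spot (π : Sym2 V → Bool) (Z : Finset (Sym2 V)) (v : V) : |spot π Z v| = 1 :=
  abs_wsign π _

/-- In a forest, two paths from a common start to the two ends of an edge differ by that edge, so the
product of their weights is the edge weight. [cite: CharikarMakarychevMakarychev2009, Cor. 5.1 proof (p. 8: "propagate values along the edges of the tree")] -/
theorem wsign_mul_wsign_of_adj (π : Sym2 V → Bool) {G : SimpleGraph V} (hG : G.IsAcyclic)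
    {r u w : V} {p : G.Walk r u} {q : G.Walk r w} (hp : p.IsPath) (hq : q.IsPath) (h : G.Adj u w) :
    wsign π p * wsign π q = esgn π s(u, w) := by
  by_cases hu : u ∈ q.support
  · have hcat : q = p.concat h := hG.path_concat hp hq h hu
    rw [hcat, wsign_concat, ← mul_assoc, wsign_mul_self, one_mul]
  · have hw : w ∈ p.support := hG.mem_support_of_ne_mem_support_of_adj_of_isPath hp hq h hu
    have hcat : p = q.concat h.symm := hG.path_concat hq hp h.symm hw
    rw [hcat, wsign_concat, Sym2.eq_swap]
    calc wsign π q * esgn π s(u, w) * wsign π q = esgn π s(u, w) * (wsign π q * wsign π q) := by ring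
      _ = esgn π s(u, w) := by rw [wsign_mul_self, mul_one]

/-- **`φ(u'')·φ(u') = π_{u'u''}` on the edges of a forest.** [cite: CharikarMakarychevMakarychev2009, Cor. 5.1 proof (p. 8)] -/
theorem spot_mul_spot_of_adj (π : Sym2 V → Bool) {Z : Finset (Sym2 V)} (hZ : (gr Z).IsAcyclic)
    {u w : V} (h : (gr Z).Adj u w) : spot π Z u * spot π Z w = esgn π s(u, w) := by
  have hr : root Z w = root Z u := (root_eq_of_reachable h.reachable).symm
  unfold spot
  -- transport the second root path to the common root
  have key : ∀ {r r' : V} (e : r' = r) (p : (gr Z).Walk r u) (q : (gr Z).Walk r' w),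
      p.IsPath → q.IsPath → wsign π p * wsign π q = esgn π s(u, w) := by
    intro r r' e p q hp hq
    subst e
    exact wsign_mul_wsign_of_adj π hZ hp hq h
  exact key hr _ _ (rootPath Z u).2 (rootPath Z w).2

/-- **In a forest `φ(u)φ(v)` is the weight of any walk from `u` to `v`** (each tree edge off the path is
traversed an even number of times). [cite: CharikarMakarychevMakarychev2009, Cor. 5.1 proof (p. 8–9)] -/
theorem spot_mul_spot_eq_wsign (π : Sym2 V → Bool) {Z : Finset (Sym2 V)} (hZ : (gr Z).IsAcyclic)
    {u v : V} (P : (gr Z).Walk u v) : spot π Z u * spot π Z v = wsign π P := by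
  induction P with
  | nil => rw [wsign_nil, spot_mul_self]
  | @cons a b c h P ih =>
    rw [wsign_cons, ← ih, ← spot_mul_spot_of_adj π hZ h]
    calc spot π Z a * spot π Z c
        = spot π Z a * (spot π Z b * spot π Z b) * spot π Z c := by rw [spot_mul_self, mul_one]
      _ = spot π Z a * spot π Z b * (spot π Z b * spot π Z c) := by ring

/-! ### The signed correlation kernel -/

section KernelDefs

variable [Fintype V] [DecidableEq V]

/-- The conditional correlation given the surviving edge set `Z`: `[u ~ v in Z]·φ(u)φ(v)`.
[cite: CharikarMakarychevMakarychev2009, Cor. 5.1 proof (p. 8–9)] -/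
def sscorr (π : Sym2 V → Bool) (Z : Finset (Sym2 V)) (u v : V) : ℝ :=
  jind Z u v * (spot π Z u * spot π Z v)

/-- **The pair-correlation kernel `E[ϕ(u)ϕ(v)]` of the weighted CMM `±1` process** driven by the
multicut distribution `p` on `E`. [cite: CharikarMakarychevMakarychev2009, Cor. 5.1 (p. 8–9)] -/
def corrS (π : Sym2 V → Bool) (p : Finset (Sym2 V) → ℝ) (E : Finset (Sym2 V)) (u v : V) : ℝ :=
  ∑ S, p S * sscorr π (E \ S) u v

end KernelDefs

section Kernel

variable [Fintype V] [DecidableEq V] (π : Sym2 V → Bool)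

/-- `|sscorr| = [u ~ v]`. [cite: CharikarMakarychevMakarychev2009, Cor. 5.1 (p. 8–9)] -/
theorem abs_sscorr (Z : Finset (Sym2 V)) (u v : V) : |sscorr π Z u v| = jind Z u v := by
  unfold sscorr
  rw [abs_mul, abs_mul, abs_spot, abs_spot, mul_one, mul_one, abs_of_nonneg (jind_nonneg _ _ _)]

/-- Symmetry. [cite: CharikarMakarychevMakarychev2009, Cor. 5.1 (p. 8–9)] -/
theorem sscorr_comm (Z : Finset (Sym2 V)) (u v : V) : sscorr π Z u v = sscorr π Z v u := by
  unfold sscorr; rw [jind_comm, mul_comm (spot π Z u)]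

/-- `sscorr u u = 1`. [cite: CharikarMakarychevMakarychev2009, Cor. 5.1 (p. 8–9)] -/
theorem sscorr_self (Z : Finset (Sym2 V)) (u : V) : sscorr π Z u u = 1 := by
  unfold sscorr; rw [jind_self, spot_mul_self, one_mul]

/-- Symmetry of the kernel. [cite: CharikarMakarychevMakarychev2009, Cor. 5.1 (p. 8–9)] -/
theorem corrS_comm (p : Finset (Sym2 V) → ℝ) (E : Finset (Sym2 V)) (u v : V) :
    corrS π p E u v = corrS π p E v u := by
  unfold corrS; exact Finset.sum_congr rfl fun S _ => by rw [sscorr_comm]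

/-- Unit diagonal. [cite: CharikarMakarychevMakarychev2009, Cor. 5.1 (p. 8–9)] -/
theorem corrS_self {p : Finset (Sym2 V) → ℝ} (hp : ∑ S, p S = 1) (E : Finset (Sym2 V)) (u : V) :
    corrS π p E u u = 1 := by
  unfold corrS; simp [sscorr_self, hp]

/-- `|E[ϕ(u)ϕ(v)]| ≤ Pr[u, v not separated]`. [cite: CharikarMakarychevMakarychev2009, Cor. 5.1 proof (p. 8–9)] -/
theorem abs_corrS_le_jointProb {p : Finset (Sym2 V) → ℝ} (hp : ∀ S, 0 ≤ p S) (E : Finset (Sym2 V))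
    (u v : V) : |corrS π p E u v| ≤ jointProb p E u v := by
  unfold corrS jointProb
  refine (abs_sum_le_sum_abs _ _).trans (le_of_eq (Finset.sum_congr rfl fun S _ => ?_))
  rw [abs_mul, abs_of_nonneg (hp S), abs_sscorr]

/-- `|E[ϕ(u)ϕ(v)]| ≤ 1`. [cite: CharikarMakarychevMakarychev2009, Cor. 5.1 (p. 8–9)] -/
theorem abs_corrS_le_one {p : Finset (Sym2 V) → ℝ} (hp : ∀ S, 0 ≤ p S) (hp1 : ∑ S, p S = 1)
    (E : Finset (Sym2 V)) (u v : V) : |corrS π p E u v| ≤ 1 := by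
  refine (abs_corrS_le_jointProb π hp E u v).trans ?_
  calc jointProb p E u v ≤ ∑ S, p S * 1 :=
        Finset.sum_le_sum fun S _ => mul_le_mul_of_nonneg_left (jind_le_one _ _ _) (hp S)
    _ = 1 := by simp [hp1]

/-- **Condition 2 gives `|E[ϕ(u)ϕ(v)]| ≤ (1−µ)^L` for `d(u,v) > L`.**
[cite: CharikarMakarychevMakarychev2009, Cor. 5.1(2) (p. 8) with Thm 2.4(2) (p. 5)] -/
theorem abs_corrS_le_of_lt_edist {μ : ℝ} {L : ℕ} {E : Finset (Sym2 V)} {p : Finset (Sym2 V) → ℝ}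
    (hG : GoodMulticut μ L E p) {u v : V} (hfar : (L : ℕ∞) < (gr E).edist u v) :
    |corrS π p E u v| ≤ (1 - μ) ^ L :=
  (abs_corrS_le_jointProb π hG.nonneg E u v).trans (hG.far u v hfar)

/-- **The signed correlation kernel is positive semidefinite** (all vertices), for every nonnegative
weight vector `p` on multicuts: `Σ x_u x_v [u~v] φ(u)φ(v) = Σ_w r_w (Σ_{u~w} φ(u)x_u)² ≥ 0`.
[cite: CharikarMakarychevMakarychev2009, Cor. 5.1 (p. 8–9) as used in Thm 5.2 (p. 9–10)] -/
theorem corrS_posSemidef_univ {p : Finset (Sym2 V) → ℝ} (hp : ∀ S, 0 ≤ p S) (E : Finset (Sym2 V)) :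
    (Matrix.of fun u v : V => corrS π p E u v).PosSemidef := by
  classical
  refine Matrix.PosSemidef.of_dotProduct_mulVec_nonneg ?_ fun x => ?_
  · exact Matrix.IsHermitian.ext fun i j => by
      simp only [of_apply, star_trivial]; exact corrS_comm _ _ _ _ _
  have hform : star x ⬝ᵥ ((Matrix.of fun u v : V => corrS π p E u v) *ᵥ x) =
      ∑ i, ∑ j, x i * x j * corrS π p E i j := by
    simp only [star_trivial, dotProduct, mulVec, of_apply, Finset.mul_sum]
    refine Finset.sum_congr rfl fun i _ => Finset.sum_congr rfl fun j _ => ?_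
    ring
  rw [hform]
  have hswap : ∑ i, ∑ j, x i * x j * corrS π p E i j =
      ∑ S, p S * ∑ i, ∑ j, x i * x j * sscorr π (E \ S) i j := by
    calc ∑ i, ∑ j, x i * x j * corrS π p E i j
        = ∑ i, ∑ j, ∑ S, p S * (x i * x j * sscorr π (E \ S) i j) := by
          refine Finset.sum_congr rfl fun i _ => Finset.sum_congr rfl fun j _ => ?_
          rw [corrS, Finset.mul_sum]
          exact Finset.sum_congr rfl fun S _ => by ring
      _ = ∑ i, ∑ S, ∑ j, p S * (x i * x j * sscorr π (E \ S) i j) :=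
          Finset.sum_congr rfl fun i _ => Finset.sum_comm
      _ = ∑ S, ∑ i, ∑ j, p S * (x i * x j * sscorr π (E \ S) i j) := Finset.sum_comm
      _ = ∑ S, p S * ∑ i, ∑ j, x i * x j * sscorr π (E \ S) i j := by
          refine Finset.sum_congr rfl fun S _ => ?_
          rw [Finset.mul_sum]
          exact Finset.sum_congr rfl fun i _ => by rw [Finset.mul_sum]
  rw [hswap]
  refine Finset.sum_nonneg fun S _ => mul_nonneg (hp S) ?_
  have : ∑ i, ∑ j, x i * x j * sscorr π (E \ S) i j =
      ∑ i ∈ (univ : Finset V), ∑ j ∈ (univ : Finset V),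
        (x i * spot π (E \ S) i) * (x j * spot π (E \ S) j) * jind (E \ S) i j :=
    Finset.sum_congr rfl fun i _ => Finset.sum_congr rfl fun j _ => by rw [sscorr]; ring
  rw [this]
  exact sum_sum_jind_nonneg (E \ S) univ (fun v => x v * spot π (E \ S) v)

/-- **The signed correlation kernel restricted to a vertex set `T` is positive semidefinite.**
[cite: CharikarMakarychevMakarychev2009, Cor. 5.1 (p. 8–9) as used in Thm 5.2 (p. 9–10)] -/
theorem corrS_posSemidef {p : Finset (Sym2 V) → ℝ} (hp : ∀ S, 0 ≤ p S) (E : Finset (Sym2 V))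
    (T : Finset V) : (Matrix.of fun i j : ↥T => corrS π p E i.1 j.1).PosSemidef :=
  (corrS_posSemidef_univ π hp E).submatrix (fun i : ↥T => i.1)

end Kernel

/-! ### The extended weights `π_uv` and the printed values -/

open Classical in
/-- **The weight `π_uv` of a pair of vertices**: the weight of a shortest path from `u` to `v` (`0` if
there is none).  The print takes "the unique shortest path"; uniqueness of the WEIGHT among shortest
paths of length `≤ L` is the hypothesis `SignConsistent` below, which holds when the girth exceeds `2L`.
[cite: CharikarMakarychevMakarychev2009, §5 (p. 8: "let π_uv be the product of the weights of all edges along the unique shortest path")] -/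
def psgn (π : Sym2 V → Bool) (E : Finset (Sym2 V)) (u v : V) : ℝ :=
  if h : (gr E).Reachable u v then wsign π h.exists_path_of_dist.choose else 0

/-- **Weight consistency of short geodesics**: any two paths of length `≤ L` with the same endpoints
have the same weight (true when all cycles are longer than `2L`, `signConsistent_of_girth`).
[cite: CharikarMakarychevMakarychev2009, §5 (p. 8: "the unique shortest path between u and v")] -/
def SignConsistent (π : Sym2 V → Bool) (E : Finset (Sym2 V)) (L : ℕ) : Prop :=
  ∀ ⦃u v : V⦄ (p q : (gr E).Walk u v), p.IsPath → q.IsPath → p.length ≤ L → q.length ≤ L →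
    wsign π p = wsign π q

section Values

variable (π : Sym2 V → Bool) {E : Finset (Sym2 V)} {L : ℕ}

/-- The chosen geodesic behind `psgn`: a path of length `dist`. [cite: CharikarMakarychevMakarychev2009, §5 (p. 8)] -/
theorem psgn_spec {u v : V} (h : (gr E).Reachable u v) :
    ∃ q : (gr E).Walk u v, q.IsPath ∧ q.length = (gr E).dist u v ∧ psgn π E u v = wsign π q := by
  classical
  refine ⟨h.exists_path_of_dist.choose, h.exists_path_of_dist.choose_spec.1,
    h.exists_path_of_dist.choose_spec.2, ?_⟩
  unfold psgn
  rw [dif_pos h]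

/-- **`π_uv` is the weight of every path of length `d(u,v) ≤ L` from `u` to `v`** (under weight
consistency). [cite: CharikarMakarychevMakarychev2009, §5 (p. 8)] -/
theorem psgn_eq_wsign (hU : SignConsistent π E L) {u v : V} (P : (gr E).Walk u v) (hP : P.IsPath)
    (hlen : P.length = (gr E).dist u v) (hL : P.length ≤ L) : psgn π E u v = wsign π P := by
  obtain ⟨q, hq, hqlen, hpsgn⟩ := psgn_spec π P.reachable
  rw [hpsgn]
  exact hU q P hq hP (by rw [hqlen, ← hlen]; exact hL) hL

/-- On an edge `π_uv` is the edge weight (`L ≥ 1`). [cite: CharikarMakarychevMakarychev2009, §5 (p. 8)] -/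
theorem psgn_of_adj (hU : SignConsistent π E L) (hL : 1 ≤ L) {u v : V} (h : (gr E).Adj u v) :
    psgn π E u v = esgn π s(u, v) := by
  have hP : (Walk.cons h Walk.nil : (gr E).Walk u v).IsPath := by
    simp [Walk.cons_isPath_iff, h.ne]
  rw [psgn_eq_wsign π hU (Walk.cons h Walk.nil) hP (by simp [SimpleGraph.dist_eq_one_iff_adj.2 h])
    (by simpa using hL)]
  simp

/-- `π_uu = 1`. [cite: CharikarMakarychevMakarychev2009, §5 (p. 8)] -/
theorem psgn_self (u : V) : psgn π E u u = 1 := by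
  obtain ⟨q, -, hqlen, hpsgn⟩ := psgn_spec π (Reachable.refl u : (gr E).Reachable u u)
  rw [SimpleGraph.dist_self] at hqlen
  have hnil : q.Nil := Walk.length_eq_zero_iff.1 hqlen
  rw [hpsgn]
  cases q with
  | nil => simp
  | cons h p => simp at hnil

/-- `π_uv = π_vu` for `d(u,v) ≤ L` (under weight consistency). [cite: CharikarMakarychevMakarychev2009, §5 (p. 8)] -/
theorem psgn_comm (hU : SignConsistent π E L) {u v : V} (huv : (gr E).edist u v ≤ L) :
    psgn π E u v = psgn π E v u := by
  by_cases h : (gr E).Reachable u v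
  · obtain ⟨q, hq, hqlen, hpsgn⟩ := psgn_spec π h
    have hdist : (gr E).dist u v ≤ L := by
      have := Reachable.coe_dist_eq_edist h
      rw [← this] at huv
      exact_mod_cast huv
    rw [hpsgn, ← wsign_reverse π q]
    refine (psgn_eq_wsign π hU q.reverse hq.reverse ?_ ?_).symm
    · rw [Walk.length_reverse, hqlen, SimpleGraph.dist_comm]
    · rw [Walk.length_reverse, hqlen]; exact hdist
  · have h' : ¬ (gr E).Reachable v u := fun h' => h h'.symm
    classical
    unfold psgn; rw [dif_neg h, dif_neg h']

variable [Fintype V] [DecidableEq V] in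
/-- **Condition 1 of Cor. 5.1 in correlation form: `d_E(u,v) = k ≤ L ⇒ E[ϕ(u)ϕ(v)] = π_uv (1−µ)^k`**
(on "not separated" the surviving piece is a tree containing a shortest path of `E`, along which the
values were propagated). [cite: CharikarMakarychevMakarychev2009, Cor. 5.1(1) (p. 8–9) with Thm 2.4(1) (p. 5)] -/
theorem corrS_eq_of_edist_le {μ : ℝ} {p : Finset (Sym2 V) → ℝ} (hG : GoodMulticut μ L E p)
    (hU : SignConsistent π E L) {u v : V} {k : ℕ} (hk : (gr E).edist u v = k) (hkL : k ≤ L) :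
    corrS π p E u v = psgn π E u v * (1 - μ) ^ k := by
  classical
  have hdistE : (gr E).dist u v = k := by
    have hr : (gr E).Reachable u v :=
      SimpleGraph.edist_ne_top_iff_reachable.1 (by rw [hk]; exact ENat.coe_ne_top k)
    have := Reachable.coe_dist_eq_edist hr
    rw [hk] at this
    exact_mod_cast this
  have hterm : ∀ S, p S ≠ 0 → sscorr π (E \ S) u v = psgn π E u v * jind (E \ S) u v := by
    intro S hS
    unfold sscorr
    by_cases hr : (gr (E \ S)).Reachable u v
    · rw [jind_of_reachable hr, one_mul, mul_one]
      -- a geodesic of the surviving forest is a shortest path of `E`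
      have hgeo := hG.geodesic S u v hS (by rw [hk]; exact_mod_cast hkL) hr
      obtain ⟨P, hP, hPlen⟩ := hr.exists_path_of_dist
      have hPk : P.length = k := by
        have := Reachable.coe_dist_eq_edist hr
        rw [hgeo, hk] at this
        rw [hPlen]; exact_mod_cast this
      rw [spot_mul_spot_eq_wsign π (hG.acyclic S hS) P]
      -- transfer `P` to `gr E`
      have hPE : ∀ e ∈ P.edges, e ∈ (gr E).edgeSet := fun e he =>
        SimpleGraph.edgeSet_mono (gr_mono sdiff_subset) (P.edges_subset_edgeSet he)
      have h1 : wsign π P = wsign π (P.transfer (gr E) hPE) :=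
        wsign_eq_of_edges_eq π (P.edges_transfer hPE).symm
      rw [h1]
      refine (psgn_eq_wsign π hU _ (hP.transfer hPE) ?_ ?_).symm
      · rw [Walk.length_transfer, hPk, hdistE]
      · rw [Walk.length_transfer, hPk]; exact hkL
    · rw [jind_of_not_reachable hr, zero_mul, mul_zero]
  unfold corrS
  have hsum : ∑ S, p S * sscorr π (E \ S) u v = ∑ S, psgn π E u v * (p S * jind (E \ S) u v) := by
    refine Finset.sum_congr rfl fun S _ => ?_
    by_cases hS : p S = 0
    · rw [hS]; ring
    · rw [hterm S hS]; ring
  rw [hsum, ← Finset.mul_sum, show ∑ S, p S * jind (E \ S) u v = jointProb p E u v from rfl,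
    hG.exact u v k hk hkL]

end Values

/-! ### Large girth gives weight consistency -/

/-- The edges of a walk in `gr E` lie in `E`. [cite: CharikarMakarychevMakarychev2010, §3.1 (p. 15)] -/
theorem mem_of_mem_edges {E : Finset (Sym2 V)} {u v : V} (p : (gr E).Walk u v) {e : Sym2 V}
    (he : e ∈ p.edges) : e ∈ E := by
  have h := p.edges_subset_edgeSet he
  rw [SimpleGraph.edgeSet_fromEdgeSet] at h
  exact mem_coe.1 h.1

/-- **If every cycle of `gr E` is longer than `2L`, shortest paths of length `≤ L` are unique, hence
weight consistent**: two distinct `u`–`v` paths of length `≤ L` would span a sub-edge-set with `≤ 2L`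
edges containing a cycle. [cite: CharikarMakarychevMakarychev2009, §5 (p. 8: "the unique shortest path between u and v", for d(u,v) ≤ 2L on graphs of girth Ω(log n))] -/
theorem signConsistent_of_girth [Fintype V] [DecidableEq V] (π : Sym2 V → Bool) {E : Finset (Sym2 V)} {g L : ℕ}
    (hgirth : ∀ (u : V) (c : (gr E).Walk u u), c.IsCycle → g ≤ c.length) (hL : 2 * L < g) :
    SignConsistent π E L := by
  classical
  intro u v p q hp hq hpL hqL
  -- the sub-edge-set spanned by the two paths
  set E₂ : Finset (Sym2 V) := p.edges.toFinset ∪ q.edges.toFinset with hE₂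
  have hE₂E : E₂ ⊆ E := by
    intro e he
    rcases mem_union.1 he with h | h
    · exact mem_of_mem_edges p (List.mem_toFinset.1 h)
    · exact mem_of_mem_edges q (List.mem_toFinset.1 h)
  have hcard : E₂.card ≤ 2 * L := by
    calc E₂.card ≤ p.edges.toFinset.card + q.edges.toFinset.card := card_union_le _ _
      _ ≤ p.edges.length + q.edges.length := add_le_add (List.toFinset_card_le _) (List.toFinset_card_le _)
      _ = p.length + q.length := by rw [Walk.length_edges, Walk.length_edges]
      _ ≤ 2 * L := by omega
  -- it is acyclic: a cycle inside it has `≤ |E₂| ≤ 2L < g` edges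
  have hacyc : (gr E₂).IsAcyclic := by
    intro w c hc
    have hlen : g ≤ c.length := girth_mono hE₂E hgirth w c hc
    have hle : c.length ≤ E₂.card := by
      rw [← Walk.length_edges, ← List.toFinset_card_of_nodup hc.isCircuit.isTrail.edges_nodup]
      exact card_le_card fun e he => mem_of_mem_edges c (List.mem_toFinset.1 he)
    omega
  -- transfer both paths into `gr E₂` and use uniqueness of paths in forests
  have hdiag : ∀ {e : Sym2 V}, e ∈ (gr E).edgeSet → ¬ e.IsDiag := fun he => by
    rw [SimpleGraph.edgeSet_fromEdgeSet] at he; exact he.2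
  have hpE₂ : ∀ e ∈ p.edges, e ∈ (gr E₂).edgeSet := fun e he => by
    rw [SimpleGraph.edgeSet_fromEdgeSet]
    exact ⟨mem_coe.2 (mem_union_left _ (List.mem_toFinset.2 he)), hdiag (p.edges_subset_edgeSet he)⟩
  have hqE₂ : ∀ e ∈ q.edges, e ∈ (gr E₂).edgeSet := fun e he => by
    rw [SimpleGraph.edgeSet_fromEdgeSet]
    exact ⟨mem_coe.2 (mem_union_right _ (List.mem_toFinset.2 he)), hdiag (q.edges_subset_edgeSet he)⟩
  have huniq := hacyc.path_unique ⟨p.transfer (gr E₂) hpE₂, hp.transfer hpE₂⟩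
    ⟨q.transfer (gr E₂) hqE₂, hq.transfer hqE₂⟩
  have hedges : p.edges = q.edges := by
    rw [← p.edges_transfer hpE₂, ← q.edges_transfer hqE₂]
    have := congrArg Subtype.val huniq
    simp only at this
    rw [this]
  exact wsign_eq_of_edges_eq π hedges

end Multicut

end Literature.Combinatorics.Optimization

end
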